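import Literature.MathematicalPhysics.QuantumFieldTheory.Balaban1983to89.T4ConvexResponse

/-!
# T⁴ programme, node NE3 (η-rate of the minimisers), route P2 «ENERGY CONVEXITY» — the ONE-PATH form of the
# energy response: strict convexity of the action ALONG ONE ADMISSIBLE C² PATH from the constrained minimiser to a
# competitor ⇒ the path's energy length is at most (dual residual at the competitor) ∕ (convexity modulus); and the
# PATH-HESSIAN LOWER BOUND that produces the modulus from tangent coercivity, Hessian continuity and the path's curvature

Eleventh generation of the NE3 prover lineage P2 of the cell `pub-balaban` (unit `b2b-balaban-t4-ne3-p2`, technique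
«energy-convexity: strict convexity of the B11 functional near the minimiser ⇒ Lipschitz dependence with explicit
modulus»; co-owner #2 of `BINDER-OWNERS.md` row NE3 under the ROUND-2 SKELETON-FIRST mandate).  This file is the
abstract KERNEL COMPOSITION announced in §1 (1d) and leaf L8 of the route's skeleton
`HOME/t4/skeletons/NE3-t4-ne3-p2.md` (v1 b28f990cfbe49615).

WHY A ONE-PATH FORM.  The lineage's accepted response layer `T4ConvexResponse.response_of_isMinOn` (§2 there) is stated
over a convex CHART `K` with `ChartC2` ∕ `StrongSecondVariation` quantified over all segments of `K`; its proof uses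
only the ONE segment from the minimiser `x*` to the competitor `w`.  On Bałaban's torus the admissible set
`{U : avgIter L U k = V}` (B7 (43)) is a non-linear fibre, straightened by B11's linearising transformation Φ ((47)
p. 285) — or, kernel-side, by the implicit function theorem over the tree's strict submersion `levelQ'` (row NE3-R2,
`AveragingDeficitMultiLevelFermat.levelQ'_onto`).  Either way what one gets cheaply is ONE admissible C² path
`γ : [0,1] → fibre` with `γ 0 = U_A` (the run-A minimiser, in a gauge) and `γ 1 = W` (the block average of the run-B
minimiser), together with bounds on `γ′`, `γ″`.  §1 restates the response bound for `φ := 𝒜 ∘ γ` alone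
(`response_along_path`, with the action-gap sandwich `actionGap_along_path` and the two-data form
`twoData_along_path`); §2 is the algebra that turns TANGENT COERCIVITY of the Hessian (the cell-SUPPLIED lemma ML at the
unit scale, skeleton leaf L5), its CONTINUITY (leaf L6), the smallness of the non-tangent part of the velocity
`γ′ = X + u_t` (leaf L2 (b)) and of the curvature term `d𝒜(γ_t)[γ″_t] =: e_t` (leaves L2 (b) + L7) into the convexity
modulus `m = c − 2Λθ − Λθ² − κ` along the path (`pathHessian_lower`, `strongConvexity_along_path`); §3 assembles
(`energyResponse_of_pathData`); §4 certifies non-vacuity on `ℝ`.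

HONEST FRAMING.  Finite-T⁴ ultraviolet bookkeeping (rung (B)+1 of the cell's ladder); [folklore] real analysis and
linear algebra over a bare real vector space; NOTHING is asserted about Bałaban's minimisers, his Hessian, Φ, or NE3;
no conditional of the cell (`BetaPertH`, (B), (B^μ)) is used or hidden; NOT infinite volume, NOT a mass gap, NOT Clay,
NOT summit progress.  ABSOLUTE RULE of the cell kept: no printed sentence is a hypothesis of any declaration (the
context citations name the displays the dictionary of the skeleton refers to: [Balaban1985Variational] (26)–(27)
p. 282, (47) p. 285, (74)–(84) pp. 289–290, (115)–(121) p. 295).  PLACEMENT (human rule 2026-08-19): our lemmas under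
`Summits/QuantumFields/BalabanUV/`; imports the accepted `Literature.….T4ConvexResponse` only (its §1 one-variable
lemmas `slope_lower`, `taylor_lower`, `taylor_upper`, `deriv_nonneg_of_isMinOn_segment` are used BY NAME); moves nothing.
-/

set_option autoImplicit false

namespace Summit.QuantumFields.BalabanUV.T4Continuum.NE3EnergyPath

open Set
open Literature.MathematicalPhysics.QuantumFieldTheory.Balaban1983to89.T4ConvexResponse
  (slope_lower taylor_lower taylor_upper deriv_nonneg_of_isMinOn_segment)

noncomputable section

/-! ## §1 The response bound along one admissible path -/

/-- One-sided Fermat at the RIGHT end: if `ψ` has derivative `D` at `1` and `ψ 1 ≤ ψ t` for `t ∈ (0,1)`, then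
`D ≤ 0` (reflection `t ↦ 1 − t` of `T4ConvexResponse.deriv_nonneg_of_isMinOn_segment`). [folklore] -/
theorem deriv_nonpos_of_isMinOn_segment_right {ψ : ℝ → ℝ} {D : ℝ} (hD : HasDerivAt ψ D 1)
    (hmin : ∀ t ∈ Ioo (0:ℝ) 1, ψ 1 ≤ ψ t) : D ≤ 0 := by
  have hcomp : HasDerivAt (fun s : ℝ => ψ (1 - s)) (D * (-1)) 0 := by
    have h1 : HasDerivAt (fun s : ℝ => 1 - s) (-1) 0 := by
      simpa using (hasDerivAt_id' (0:ℝ)).const_sub 1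
    have hD' : HasDerivAt ψ D (1 - 0) := by simpa using hD
    exact hD'.comp 0 h1
  have hmin' : ∀ t ∈ Ioo (0:ℝ) 1, (fun s : ℝ => ψ (1 - s)) 0 ≤ (fun s : ℝ => ψ (1 - s)) t := by
    intro t ht
    simp only [sub_zero]
    exact hmin (1 - t) ⟨by linarith [ht.2], by linarith [ht.1]⟩
  have := deriv_nonneg_of_isMinOn_segment hcomp hmin'
  linarith

/-- **ENERGY RESPONSE ALONG ONE PATH (strict convexity ⇒ Lipschitz response, modulus 1/m).**  Let `φ = 𝒜 ∘ γ` be the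
action along an admissible C² path, `γ 0` the constrained minimiser (so `φ 0 ≤ φ t`), `γ 1` the competitor; if
`φ″ ≥ m·ℓ²` on `[0,1]` (`ℓ ≥ 0` the energy length of the path, `m > 0`) and the derivative at the competitor's end is
bounded by the dual residual, `φ′ 1 ≤ r·ℓ`, then `ℓ ≤ r / m`.  Dictionary (skeleton §1): `ℓ = N_W(X)`, `r = r_k` from
row NE3-R2's `dualResidual_avgIter`, `m = c_T/2`. [folklore] -/
theorem response_along_path {φ φ' φ'' : ℝ → ℝ} {m r ℓ : ℝ}
    (h1 : ∀ t ∈ Icc (0:ℝ) 1, HasDerivAt φ (φ' t) t) (h2 : ∀ t ∈ Icc (0:ℝ) 1, HasDerivAt φ' (φ'' t) t)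
    (hconv : ∀ t ∈ Icc (0:ℝ) 1, m * ℓ ^ 2 ≤ φ'' t) (hmin : ∀ t ∈ Ioo (0:ℝ) 1, φ 0 ≤ φ t)
    (hres : φ' 1 ≤ r * ℓ) (hm : 0 < m) (hℓ : 0 ≤ ℓ) (hr : 0 ≤ r) : ℓ ≤ r / m := by
  have h0 : (0:ℝ) ∈ Icc (0:ℝ) 1 := by simp
  have h1' : (1:ℝ) ∈ Icc (0:ℝ) 1 := by simp
  have hVI : 0 ≤ φ' 0 := deriv_nonneg_of_isMinOn_segment (h1 0 h0) hmin
  have key := slope_lower h2 hconv h0 h1' zero_le_one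
  -- key : m * ℓ ^ 2 * (1 - 0) ≤ φ' 1 - φ' 0
  have hmn : m * ℓ ^ 2 ≤ r * ℓ := by nlinarith
  rcases hℓ.eq_or_lt with hz | hpos
  · rw [← hz]; positivity
  · rw [le_div_iff₀ hm]
    have : m * ℓ * ℓ ≤ r * ℓ := by nlinarith
    have := le_of_mul_le_mul_right this hpos
    linarith

/-- **ACTION GAP ALONG THE PATH** (both halves): with `φ″ ≥ m ℓ²` on `[0,1]`, minimality at `t = 0` and the residual
bound `φ′ 1 ≤ r ℓ` at `t = 1`:  `(m/2) ℓ² ≤ φ 1 − φ 0 ≤ r²/(2m)` — the competitor's action exceeds the minimum by at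
least the quadratic energy distance and by at most the SQUARE of the dual residual over `2m` (the action reading of
NE3 carries the rate squared). [folklore] -/
theorem actionGap_along_path {φ φ' φ'' : ℝ → ℝ} {m r ℓ : ℝ}
    (h1 : ∀ t ∈ Icc (0:ℝ) 1, HasDerivAt φ (φ' t) t) (h2 : ∀ t ∈ Icc (0:ℝ) 1, HasDerivAt φ' (φ'' t) t)
    (hconv : ∀ t ∈ Icc (0:ℝ) 1, m * ℓ ^ 2 ≤ φ'' t) (hmin : ∀ t ∈ Ioo (0:ℝ) 1, φ 0 ≤ φ t)
    (hres : φ' 1 ≤ r * ℓ) (hm : 0 < m) :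
    m / 2 * ℓ ^ 2 ≤ φ 1 - φ 0 ∧ φ 1 - φ 0 ≤ r ^ 2 / (2 * m) := by
  have h0 : (0:ℝ) ∈ Icc (0:ℝ) 1 := by simp
  have hVI : 0 ≤ φ' 0 := deriv_nonneg_of_isMinOn_segment (h1 0 h0) hmin
  have lo := taylor_lower h1 h2 hconv
  have up := taylor_upper h1 h2 hconv
  refine ⟨by linarith, ?_⟩
  have hA : φ 1 - φ 0 ≤ r * ℓ - m * ℓ ^ 2 / 2 := by linarith
  have hB : r * ℓ - m * ℓ ^ 2 / 2 ≤ r ^ 2 / (2 * m) := by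
    rw [le_div_iff₀ (by positivity)]
    nlinarith [sq_nonneg (r - m * ℓ)]
  linarith

/-- **TWO-DATA FORM ALONG ONE PATH** (Lipschitz dependence of the constrained minimiser on the data, modulus 1/m):
two functionals `φ₁ = 𝒜₁ ∘ γ`, `φ₂ = 𝒜₂ ∘ γ` along the same admissible path, `γ 0` minimising the first (`φ₁ 0 ≤ φ₁ t`)
and `γ 1` the second (`φ₂ 1 ≤ φ₂ t`); if `φ₁″ ≥ m ℓ²` on `[0,1]` and the first variations at `t = 1` differ by at most
`δ ℓ` (`φ₁′ 1 − D₂ ≤ δ ℓ`, `D₂` the derivative of `φ₂` at `1`), then `ℓ ≤ δ / m`.  Dictionary (skeleton ROOT T-LIP): the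
two functionals are `𝔉_W(· + H_W B₁)` and `𝔉_W(· + H_W B₂)` on the common tangent space, `δ = Λ C_H ‖B₁ − B₂‖`.
[folklore] -/
theorem twoData_along_path {φ₁ φ₁' φ₁'' φ₂ : ℝ → ℝ} {D₂ m δ ℓ : ℝ}
    (h1 : ∀ t ∈ Icc (0:ℝ) 1, HasDerivAt φ₁ (φ₁' t) t) (h2 : ∀ t ∈ Icc (0:ℝ) 1, HasDerivAt φ₁' (φ₁'' t) t)
    (hconv : ∀ t ∈ Icc (0:ℝ) 1, m * ℓ ^ 2 ≤ φ₁'' t) (hmin₁ : ∀ t ∈ Ioo (0:ℝ) 1, φ₁ 0 ≤ φ₁ t)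
    (hD₂ : HasDerivAt φ₂ D₂ 1) (hmin₂ : ∀ t ∈ Ioo (0:ℝ) 1, φ₂ 1 ≤ φ₂ t)
    (hdiff : φ₁' 1 - D₂ ≤ δ * ℓ) (hm : 0 < m) (hℓ : 0 ≤ ℓ) (hδ : 0 ≤ δ) : ℓ ≤ δ / m := by
  have hD₂' : D₂ ≤ 0 := deriv_nonpos_of_isMinOn_segment_right hD₂ hmin₂
  exact response_along_path h1 h2 hconv hmin₁ (by linarith) hm hℓ hδ

/-! ## §2 The path-Hessian lower bound: tangent coercivity + continuity + small non-tangent velocity + small curvature term -/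

section Hessian

variable {E : Type*} [AddCommGroup E] [Module ℝ E]

/-- Expansion of a symmetric bilinear form on a sum. [folklore] -/
theorem bilin_add_add (Hs : E →ₗ[ℝ] E →ₗ[ℝ] ℝ) (hsymm : ∀ x y, Hs x y = Hs y x) (X u : E) :
    Hs (X + u) (X + u) = Hs X X + 2 * Hs X u + Hs u u := by
  simp only [map_add, LinearMap.add_apply]
  rw [hsymm u X]
  ring

/-- **PATH-HESSIAN LOWER BOUND.**  Let `Hs` be a symmetric bilinear form (the Hessian of the action at a point of the
path), `c`-coercive on the tangent space `T` in the gauge `N` (`c·N(Y)² ≤ Hs Y Y` for `Y ∈ T` — the cell-SUPPLIED lemma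
ML at the unit scale, skeleton leaf L5) and `Λ`-continuous (`|Hs Y Z| ≤ Λ N(Y) N(Z)`, leaf L6).  If the path velocity is
`X + u` with `X ∈ T` and a non-tangent correction `N(u) ≤ θ N(X)` (leaf L2 (b): `u = −(H𝔇)X`-type, `θ = O(ε₃)`), and the
curvature term `e = d𝒜[γ″]` satisfies `|e| ≤ κ N(X)²` (leaves L2 (b) + L7), then
`(c − 2Λθ − Λθ² − κ)·N(X)² ≤ Hs (X+u) (X+u) + e` — the second derivative of the action along the path is bounded below
by an explicit multiple of the squared energy length. [folklore] -/
theorem pathHessian_lower (Hs : E →ₗ[ℝ] E →ₗ[ℝ] ℝ) (hsymm : ∀ x y, Hs x y = Hs y x) (N : E → ℝ)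
    (hN : ∀ v, 0 ≤ N v) (T : Set E) {c Λ θ κ : ℝ} (hΛ : 0 ≤ Λ)
    (hcoer : ∀ Y ∈ T, c * N Y ^ 2 ≤ Hs Y Y) (hcont : ∀ Y Z, |Hs Y Z| ≤ Λ * N Y * N Z)
    {X u : E} (hX : X ∈ T) (hu : N u ≤ θ * N X) {e : ℝ} (he : |e| ≤ κ * N X ^ 2) :
    (c - 2 * Λ * θ - Λ * θ ^ 2 - κ) * N X ^ 2 ≤ Hs (X + u) (X + u) + e := by
  rw [bilin_add_add Hs hsymm]
  have hXX := hcoer X hX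
  have hXu := (abs_le.mp (hcont X u))
  have huu := (abs_le.mp (hcont u u))
  have he' := (abs_le.mp he)
  have hNX := hN X
  have hNu := hN u
  -- Λ N X N u ≤ Λ θ N X ²,  Λ N u N u ≤ Λ θ² N X²
  have h1 : Λ * N X * N u ≤ Λ * θ * N X ^ 2 := by
    have := mul_le_mul_of_nonneg_left hu (mul_nonneg hΛ hNX)
    nlinarith
  have hθ : 0 ≤ θ * N X := le_trans hNu hu
  have h2 : Λ * N u * N u ≤ Λ * θ ^ 2 * N X ^ 2 := by
    have hsq : N u * N u ≤ (θ * N X) * (θ * N X) := mul_self_le_mul_self hNu hu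
    have := mul_le_mul_of_nonneg_left hsq hΛ
    nlinarith
  nlinarith

/-- COERCIVITY IS STABLE along the chart: if `H₀` is `c`-coercive on `T` and `Hs` is `ζ`-close to `H₀` on the diagonal
in the gauge `N` (`|Hs Y Y − H₀ Y Y| ≤ ζ N(Y)²` — skeleton leaf L6 (b): the cubic/quartic remainders at a chart point
`A`, `ζ = O(sup|A| + sup|∇A|)`), then `Hs` is `(c − ζ)`-coercive on `T`. [folklore] -/
theorem coercive_of_near (H₀ Hs : E →ₗ[ℝ] E →ₗ[ℝ] ℝ) (N : E → ℝ) (T : Set E) {c ζ : ℝ}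
    (hcoer : ∀ Y ∈ T, c * N Y ^ 2 ≤ H₀ Y Y) (hnear : ∀ Y, |Hs Y Y - H₀ Y Y| ≤ ζ * N Y ^ 2) :
    ∀ Y ∈ T, (c - ζ) * N Y ^ 2 ≤ Hs Y Y := by
  intro Y hY
  have h := abs_le.mp (hnear Y)
  have := hcoer Y hY
  nlinarith

/-- **STRONG CONVEXITY ALONG THE PATH** (skeleton leaf L8, abstract form): if at every `t ∈ [0,1]` the second
derivative of `φ = 𝒜 ∘ γ` splits as `φ″ t = Hs t (X + u t) (X + u t) + e t` with `Hs t` symmetric, `c`-coercive on `T`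
and `Λ`-continuous in the gauge `N`, `X ∈ T`, `N (u t) ≤ θ N X` and `|e t| ≤ κ N(X)²`, then
`φ″ ≥ (c − 2Λθ − Λθ² − κ)·N(X)²` on `[0,1]` — the hypothesis `hconv` of `response_along_path` with `ℓ = N X`. [folklore] -/
theorem strongConvexity_along_path {φ'' : ℝ → ℝ} (Hs : ℝ → E →ₗ[ℝ] E →ₗ[ℝ] ℝ)
    (hsymm : ∀ t ∈ Icc (0:ℝ) 1, ∀ x y, Hs t x y = Hs t y x) (N : E → ℝ) (hN : ∀ v, 0 ≤ N v) (T : Set E)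
    {c Λ θ κ : ℝ} (hΛ : 0 ≤ Λ)
    (hcoer : ∀ t ∈ Icc (0:ℝ) 1, ∀ Y ∈ T, c * N Y ^ 2 ≤ Hs t Y Y)
    (hcont : ∀ t ∈ Icc (0:ℝ) 1, ∀ Y Z, |Hs t Y Z| ≤ Λ * N Y * N Z)
    {X : E} (hX : X ∈ T) (u : ℝ → E) (hu : ∀ t ∈ Icc (0:ℝ) 1, N (u t) ≤ θ * N X)
    (e : ℝ → ℝ) (he : ∀ t ∈ Icc (0:ℝ) 1, |e t| ≤ κ * N X ^ 2)
    (hsplit : ∀ t ∈ Icc (0:ℝ) 1, φ'' t = Hs t (X + u t) (X + u t) + e t) :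
    ∀ t ∈ Icc (0:ℝ) 1, (c - 2 * Λ * θ - Λ * θ ^ 2 - κ) * N X ^ 2 ≤ φ'' t := by
  intro t ht
  rw [hsplit t ht]
  exact pathHessian_lower (Hs t) (hsymm t ht) N hN T hΛ (hcoer t ht) (hcont t ht) hX (hu t ht) (he t ht)

/-! ## §3 Assembly: the energy response from path data -/

/-- **THE ENERGY RESPONSE FROM PATH DATA** (§1 + §2): under the splitting of `strongConvexity_along_path` with
`m := c − 2Λθ − Λθ² − κ > 0`, minimality of `γ 0` and the dual-residual bound `φ′ 1 ≤ r·N(X)` at the competitor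
`γ 1`, the energy length of the path obeys `N X ≤ r / m`.  This is the composition the typer's torus file instantiates
(skeleton §1: X = the Landau-gauge chart coordinate of U_k relative to W = rescale∘bavg U_{k+1}; r = r_k of row NE3-R2's
`dualResidual_avgIter`; c = c_T of leaf L5). [folklore] -/
theorem energyResponse_of_pathData {φ φ' φ'' : ℝ → ℝ} (Hs : ℝ → E →ₗ[ℝ] E →ₗ[ℝ] ℝ)
    (hsymm : ∀ t ∈ Icc (0:ℝ) 1, ∀ x y, Hs t x y = Hs t y x) (N : E → ℝ) (hN : ∀ v, 0 ≤ N v) (T : Set E)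
    {c Λ θ κ r : ℝ} (hΛ : 0 ≤ Λ) (hr : 0 ≤ r)
    (hcoer : ∀ t ∈ Icc (0:ℝ) 1, ∀ Y ∈ T, c * N Y ^ 2 ≤ Hs t Y Y)
    (hcont : ∀ t ∈ Icc (0:ℝ) 1, ∀ Y Z, |Hs t Y Z| ≤ Λ * N Y * N Z)
    {X : E} (hX : X ∈ T) (u : ℝ → E) (hu : ∀ t ∈ Icc (0:ℝ) 1, N (u t) ≤ θ * N X)
    (e : ℝ → ℝ) (he : ∀ t ∈ Icc (0:ℝ) 1, |e t| ≤ κ * N X ^ 2)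
    (h1 : ∀ t ∈ Icc (0:ℝ) 1, HasDerivAt φ (φ' t) t) (h2 : ∀ t ∈ Icc (0:ℝ) 1, HasDerivAt φ' (φ'' t) t)
    (hsplit : ∀ t ∈ Icc (0:ℝ) 1, φ'' t = Hs t (X + u t) (X + u t) + e t)
    (hmin : ∀ t ∈ Ioo (0:ℝ) 1, φ 0 ≤ φ t) (hres : φ' 1 ≤ r * N X)
    (hm : 0 < c - 2 * Λ * θ - Λ * θ ^ 2 - κ) :
    N X ≤ r / (c - 2 * Λ * θ - Λ * θ ^ 2 - κ) :=
  response_along_path h1 h2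
    (strongConvexity_along_path Hs hsymm N hN T hΛ hcoer hcont hX u hu e he hsplit) hmin hres hm (hN X) hr

/-- The MODULUS BUDGET (cf. `B11HessianL2.hessian_lower_of_budget`): if the three perturbation prices stay within half
the coercivity, `2Λθ + Λθ² + κ ≤ c/2`, the path modulus is at least `c/2` (the skeleton's `m = c_T/2`). [folklore] -/
theorem modulus_ge_half {c Λ θ κ : ℝ} (h : 2 * Λ * θ + Λ * θ ^ 2 + κ ≤ c / 2) :
    c / 2 ≤ c - 2 * Λ * θ - Λ * θ ^ 2 - κ := by linarith

/-- Under the budget, the response bound with the displayed modulus `2/c`: `N X ≤ 2 r / c`. [folklore] -/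
theorem energyResponse_half {c r n : ℝ} (hc : 0 < c) (hr : 0 ≤ r) {m : ℝ} (hm : c / 2 ≤ m)
    (h : n ≤ r / m) : n ≤ 2 * r / c := by
  have hm0 : 0 < m := lt_of_lt_of_le (by linarith) hm
  refine h.trans ?_
  rw [div_le_div_iff₀ hm0 hc]
  nlinarith

end Hessian

/-! ## §4 Non-vacuity: the hypotheses of §1–§3 are jointly satisfiable, with the bound attained -/

namespace Witness

/-- On `E = ℝ` the symmetric bilinear form `(x, y) ↦ 2xy` is `LinearMap.mul ℝ ℝ ∘ₗ (2 • id)`: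
`(LinearMap.mul ℝ ℝ ∘ₗ ((2 : ℝ) • LinearMap.id)) x y = 2xy`. [folklore] -/
theorem Hsq_apply (x y : ℝ) : (LinearMap.mul ℝ ℝ ∘ₗ ((2 : ℝ) • LinearMap.id)) x y = 2 * x * y := by
  simp

/-- The witness instance of `energyResponse_of_pathData` (non-vacuity of §3; the bound `N X ≤ r/m` reads
`|ℓ| ≤ 2ℓ/2`, attained for `ℓ ≥ 0`): `φ t = ℓ² t²`, `Hs = 2xy`, `N = |·|`, `T = univ`, `X = ℓ`, `u = e = 0`, `c = Λ = 2`, `θ = κ = 0`, `r = 2ℓ`. [folklore] -/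
theorem energyResponse_witness (ℓ : ℝ) (hℓ : 0 ≤ ℓ) : |ℓ| ≤ (2 * ℓ) / (2 - 2 * 2 * 0 - 2 * 0 ^ 2 - 0) :=
  energyResponse_of_pathData (E := ℝ) (φ := fun t => ℓ ^ 2 * t ^ 2) (φ' := fun t => 2 * ℓ ^ 2 * t)
    (φ'' := fun _ => 2 * ℓ ^ 2) (fun _ => LinearMap.mul ℝ ℝ ∘ₗ ((2 : ℝ) • LinearMap.id)) (fun _ _ x y => by rw [Hsq_apply, Hsq_apply]; ring)
    (fun v => |v|) (fun v => abs_nonneg v) Set.univ (c := 2) (Λ := 2) (θ := 0) (κ := 0) (r := 2 * ℓ)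
    zero_le_two (by positivity)
    (fun _ _ Y _ => by rw [Hsq_apply, sq_abs]; nlinarith)
    (fun _ _ Y Z => by rw [Hsq_apply, abs_mul, abs_mul, abs_two])
    (X := ℓ) (Set.mem_univ _) (fun _ => 0) (fun _ _ => by simp)
    (fun _ => 0) (fun _ _ => by simp)
    (fun t _ => ((hasDerivAt_pow 2 t).const_mul (ℓ ^ 2)).congr_deriv (by push_cast; ring))
    (fun t _ => ((hasDerivAt_id' t).const_mul (2 * ℓ ^ 2)).congr_deriv (by ring))
    (fun _ _ => by rw [Hsq_apply]; ring)
    (fun t _ => by nlinarith [sq_nonneg (ℓ * t)])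
    (by rw [abs_of_nonneg hℓ]; nlinarith)
    (by norm_num)

/-- The same, simplified: `|ℓ| ≤ ℓ` for `ℓ ≥ 0` — the response bound is attained. [folklore] -/
theorem energyResponse_witness' (ℓ : ℝ) (hℓ : 0 ≤ ℓ) : |ℓ| ≤ ℓ := by
  have h := energyResponse_witness ℓ hℓ
  norm_num at h
  linarith

end Witness

end

end Summit.QuantumFields.BalabanUV.T4Continuum.NE3EnergyPath
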